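import Literature.Barriers.ResolutionOfSingularities.ResidualOrderUnbounded
import Literature.AlgebraicGeometry.Resolution.PointBlowupShadeCentres
import HarnessLib
import HarnessLib.Audit.Tags

/-!
# The plateau law Π of CARD I-5-5 — TYPED STATEMENT (cell `res-dim4-pi`, res-dim4-idea-5; for the provers)

[OURS · CANDIDATE FRAME · counted 0]  Nothing here is a statement about resolution of singularities in
dimension ≥ 4 / characteristic `p`, which is NOT proved; Π is a persistence / no-rise law for one point
letter under POINT blow-ups (desk MODE 0), not a decrease at jumps (standing no-go (C) untouched).
This module only TYPES the statement of res-dim4-idea-5's consolidated write-up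
`pub/res-dim4/res-dim4-idea-5/PiPlateau-consolidated.md` (sha16 ecef900b4de1a97c, §0 and §5; pen proof by
idea-5 / crit-2 / crit-3, «three AI hands, expert review wanted») over TREE vocabulary, so that the proof
bricks (`…HasseEuler*` = the regime-R algebra; T1–T4/T9 to come) conclude it BY NAME:

* states are the coordinate-walk states `CentreBlowup.CState σ K` (`F`, bookkept `r`, exceptional set
  `exc = Δ`); the edge is the POINT blow-up `CentreBlowup.step q univ j t s` (chart `j`, translation `t`
  with `t j = 0`, then cleaning), any number of variables `σ`;
* letters, read LITERALLY from `(F, Δ)` as in the write-up §0: `o = ordZero F`,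
  `r_k = ord_{(x_k)} F` (`k ∈ Δ`), `d = residual order = HauserPerlega.residualOrder Δ F`
  (`Literature/Barriers/…/ResidualOrderUnbounded`), and the NEW letter `Plateau.IsVActive q Δ F` («`V_q = 1`»: some
  initial monomial `x^a`, `|a| = o`, has a NON-exceptional variable `i ∉ Δ` with `q ∤ a_i`);
* `Plateau.PiEdge` — the per-edge statement «(J0⁺) `d′ ≤ d` and (Π) `d′ = d ⇒ V_q′ = 1`» for a clean `q`-fold
  `V_q`-active parent and a non-zero child; `PiPlateau p e` — its closure over all `σ`, all fields of
  characteristic `p`, `q = p^e`, all states and MODE-0 edges.  `@[conjecture]`-free: it is a typed TARGET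
  (idea-5's theorem-candidate), asserted nowhere in this file.

Remark (crit-2 V-B-15): on cleaned MODE-0 states the literal `r_k` agree with the bookkept `s.r`, so the
engines' letters can be read either way; the statement uses the literal ones of the write-up.
Typed by res-dim4-typ-1.  Supports stmt-ResolutionOfSingularities-16155 (helper).
bears_on: LADDER-RESOLUTION:D157-DOOR2 (res-dim4-pi · I-5-5 Π statement).
-/

set_option linter.dupNamespace false -- mandated namespace of this single-conjunct summit

namespace Summit.ResolutionOfSingularities.ResolutionOfSingularities.Theorems.PIDim4

open MvPolynomial Finset
open Literature.AlgebraicGeometry.Resolution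
open Literature.AlgebraicGeometry.Resolution.Hauser2010
open Literature.Barriers.ResolutionOfSingularities

namespace Plateau

variable {σ : Type*} {K : Type*} [CommRing K]

/-- **`V_q(F, Δ) = 1`** (write-up §0): some INITIAL monomial `x^a` of `F` (`|a| = ord₀ F`) has a
NON-exceptional variable `i ∉ Δ` whose exponent is NOT divisible by `q`; the pair `(a, i)` is a WITNESS.
[OURS · res-dim4-idea-5 CARD I-5-5] -/
def IsVActive (q : ℕ) (Δ : Finset σ) (F : MvPolynomial σ K) : Prop :=
  ∃ a ∈ F.support, ((Finsupp.degree a : ℕ) : ℕ∞) = ordZero F ∧ ∃ i, i ∉ Δ ∧ ¬ q ∣ a i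

/-- **Π on one MODE-0 edge** (write-up §5, data explicit): for the state `s = (F, r, Δ)` with `F` clean,
`q`-fold (`ord₀ F ≥ q`) and `V_q`-active, and the point blow-up in the chart `j` with translation `t`
(`t j = 0`) whose cleaned child `F′` is non-zero:
**(J0⁺)** `d′ ≤ d` and **(Π)** `d′ = d ⇒ V_q′ = 1`, where `d = HauserPerlega.residualOrder Δ F` (literal
residual order) and `Δ′ = (CentreBlowup.step q univ j t s).exc`. [OURS · res-dim4-idea-5 CARD I-5-5] -/
def PiEdge [Fintype σ] [DecidableEq σ] [DecidableEq K] (q : ℕ) (s : CentreBlowup.CState σ K)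
    (j : σ) (t : σ → K) : Prop :=
  t j = 0 → HauserPerlega.IsClean q s.F → ((q : ℕ) : ℕ∞) ≤ ordZero s.F → IsVActive q s.exc s.F →
    (CentreBlowup.step q Finset.univ j t s).F ≠ 0 →
      HauserPerlega.residualOrder (CentreBlowup.step q Finset.univ j t s).exc
          (CentreBlowup.step q Finset.univ j t s).F ≤ HauserPerlega.residualOrder s.exc s.F ∧
        (HauserPerlega.residualOrder (CentreBlowup.step q Finset.univ j t s).exc
            (CentreBlowup.step q Finset.univ j t s).F = HauserPerlega.residualOrder s.exc s.F →
          IsVActive q (CentreBlowup.step q Finset.univ j t s).exc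
            (CentreBlowup.step q Finset.univ j t s).F)

end Plateau

/-- **THE PLATEAU LAW Π** (res-dim4-idea-5 CARD I-5-5, consolidated write-up §5; pen proof idea-5 /
crit-2 / crit-3): for `q = p^e`, over EVERY field of characteristic `p`, in ANY number of variables, on
EVERY MODE-0 edge from a clean `q`-fold `V_q`-active state with non-zero child: `d′ ≤ d`, and `d′ = d`
forces `V_q′ = 1`.  Equivalently `ω_q := d − [V_q]` does not increase while `V_q = 1`.  A typed TARGET —
asserted nowhere here. [OURS · CANDIDATE · res-dim4-idea-5 CARD I-5-5] -/
def PiPlateau (p e : ℕ) : Prop :=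
  ∀ (σ : Type) [Fintype σ] [DecidableEq σ] (K : Type) [Field K] [CharP K p] [DecidableEq K]
    (s : CentreBlowup.CState σ K) (j : σ) (t : σ → K), Plateau.PiEdge (p ^ e) s j t

end Summit.ResolutionOfSingularities.ResolutionOfSingularities.Theorems.PIDim4
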